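/-
Copyright (c) 2026 the pub-hodgecm-mathlib formalisation cell (harness21).  Prover seat hodgecm-mathlib-K2E5-p01 (g2),
Track B «K2-LIT» ∕ h413, engine E5 «TamagawaUnitary», unit G «ZETA ∕ DESCENT», support of G3 (Tate–Fujisaki for `D_h`):
THETA SUMS OVER THE LATTICE `D_h ⊂ D_{h,𝔸}` ALONG THE CENTRAL RAY (K2E5-plan (g2) RULING (A)(1) 2026-09-03T23:30:59Z «K2E5-p01 (g2) KEEPS
`Theorems/K2E5QuatThetaBounds.lean`»; consumer K2E5-p07's ★ `K2E5QuatZetaAbsConvOfThetaBounds`, hypotheses (H3±)).  2026-09-03∕04.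
-/
import Summits.HodgeConjecture.HodgeConjecture.Theorems.K2E5QuatLeftMulDefs             -- ★ DEFS LEAF (this seat): `leftMulGL`, `coe_mul_quatCoord_eq`, `continuous_leftMulGL`, `coe_quatModuleSection_mul_quatCoord`, `smul_vecMul_eq_vecMul_mul_posRealScalar`
import Summits.HodgeConjecture.HodgeConjecture.Theorems.K2E5QuatPoissonTransport         -- ★ (K2E5-p14): `coe_equivFun_symm_quatBasis`, `map_sum_smul_quatBasis_eq_quatCoord`; brings ★ #3j∕#3j-bis
import Literature.NumberTheory.Automorphic.AdelicThetaTailRayDecay                      -- ★ `exists_tsum_enorm_vecMul_tail_ray_le_archHeight_rpow` (tail of theta sums along the ray)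
import Literature.NumberTheory.Automorphic.MirabolicEisensteinResidue                   -- ★ `exists_decay_of_mem_piSchwartzBruhat` (decay ∕ support of Schwartz–Bruhat functions)
import Literature.NumberTheory.Automorphic.AdelicHeightGLSiegel                         -- ★ `GLn.continuous_archHeight`
import Literature.NumberTheory.Automorphic.AutomorphicFormsGLContinuous                 -- ★ `GLn.continuous_sndHom`
import HarnessLib

/-!
# K2 ∕ E5 «TamagawaUnitary», unit G — `K2E5QuatThetaBounds`: theta sums `Σ_{γ ∈ Γ_h} ‖Φ(y γ θ_t)‖` of a Schwartz–Bruhat function of `D_{h,𝔸}`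
# along the central ray decay like `e^{−κ t}` for EVERY `κ > 1`, uniformly for `y` in a compact set

Cell `pub/hodgecm-mathlib` (D-0151), Track B (21-frontier RULING «PUSH BOTH» 2026-09-03, director req624, chair K2-lead), item h413 =
`stmt-HodgeConjecture-24833`; lane `--kind proof --supports stmt-HodgeConjecture-24833 --as helper`.  Ruled to this seat by the E5 dealer K2E5-plan (g2)
(RULING (A)(1), 2026-09-03T23:30:59Z) on K2E5-p07's census `QuatZetaAbsConv-CORE-census.md` (road 2); the consumer is K2E5-p07's ★ (β)-skeleton
`K2E5QuatZetaAbsConvOfThetaBounds.quatZeta_majorant_integrable_of_thetaBounds` (hypotheses (H3⁺) `hplus`, (H3⁻) `hminus`), hence socket G3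
`Zeta.sig_K2E5QuatZetaResidue` and G11 `sig_K2E5QuatZetaAbsConv` of `Cruxes/H413/Lines/K2_E5_TamagawaUnitary_Zeta.lean`.

THE MATHEMATICS [WeilBNT1967, Ch. VII §5 (Prop. 11), §6; VignerasLNM800, Ch. III §2 (proof of Thm. 2.2); GodementJacquetLNM260, §11 Lemmas 11.5–11.6;
TateThesis1967, §4.4].  Let `h` be a non-degenerate hermitian plane over the CM field `L`, `D_h ⊂ M₂(L)` its quaternion algebra over `K = L⁺` (★ #3d), with the
`K`-basis `e = quatBasis` (★ #3g) and the coordinate isomorphism `quatCoord e : 𝔸_K⁴ ≃ D_{h,𝔸}` (★ `quatCoordEquiv`).  LEFT MULTIPLICATION by a unit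
`y ∈ (D_h ⊗ 𝔸)^×` is `𝔸_K`-linear on `D_{h,𝔸}`, hence in coordinates a matrix `M(y) ∈ GL₄(𝔸_K)` depending continuously on `y`:
`y · quatCoord e (a) = quatCoord e (a ᵥ* M(y))` (§1 `exists_leftMulGL`).  The central section `θ_τ = quatModuleSection τ` (★ #3j-bis; module `τ`) is the scalar
idèle `posRealIdele K (τ^{1∕4d})` (`d = [K : ℚ]`), so `y θ_τ · quatCoord e (ξ) = Ψ`-argument `ξ ᵥ* (M(y) · z(τ^{1∕4d}))` with `z = posRealScalar 4 K` and
`Ψ = Φ ∘ quatCoord e ∈ 𝒮(𝔸_K⁴)` for `Φ ∈ quatSchwartzBruhat` (★ #3g, definitional) (§2).  A rational quaternion unit `γ ∈ Γ_h = D_h^×` is `quatCoord e (ξ_γ)` for a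
NON-ZERO rational vector `ξ_γ ∈ K⁴`, injectively in `γ` (§3 `tsum_quatRatLatticeOne_le_tsum_coord`).  Therefore the theta TAIL bound of the tree —
★ `AdelicThetaTailRayDecay.exists_tsum_enorm_vecMul_tail_ray_le_archHeight_rpow`: `Σ_{ξ ≠ 0} ‖Ψ(ξ ᵥ* L z(r)⁻¹)‖ ≤ r^θ · B · (1 ⊔ 16 H_∞(L))^θ` for `L_f` in a
compact set, every `r > 0` and every `θ ∈ (4d, k]` where `k` is an archimedean decay order of `Ψ` (★ `exists_decay_of_mem_piSchwartzBruhat`: EVERY `k`) — applied at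
`L = M(y)` (`y` in a compact set: `M(y)_f` compact, `H_∞(M(y))` bounded, ★ `GLn.continuous_sndHom` ∕ `continuous_archHeight`), `r = τ^{−1∕4d}`, `θ = 4dκ`, gives
for `τ = e^t`:

  `Σ_{γ ∈ Γ_h} ‖Φ(y γ θ_{e^t})‖ ≤ B_κ · e^{−κ t}`   for ALL real `t`, EVERY `κ > 1`, uniformly for `y ∈ K` compact   (§4–§5, `thetaTail_le_exp`).

For `t > 0` this is RAPID DECAY at any rate (K2E5-p07's (H3⁺) with `κ = σ + 1`, his bytes exactly: `thetaTail_plus`); for `t ≤ 0` it is GROWTH `e^{κ|t|}` with `κ`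
arbitrarily close to `1` — the «crude» contracting bound, which still yields absolute convergence of `Z_h(Φ, s)` for EVERY `σ > 1` (take `κ ∈ (1, σ)`); the SHARP
`e^{|t|}` (exponent exactly one = module⁻¹) is Poisson summation (K2E5-p14's dilation identity) and is NOT claimed here — HONEST GAP recorded on the K2 bus
(2026-09-03T23:42Z) with the 5-line relaxation of (β)'s `hminus` it requires.

* §1–§2 (left multiplication `M(y)` in coordinates, the central ray in coordinates) live in the companion DEFS LEAF ★ `K2E5QuatLeftMulDefs` (this seat);
* §3 `tsum_quatRatLatticeOne_le_tsum_coord` — `Σ_{γ ∈ Γ_h} G(γ) ≤ Σ_{ξ ∈ K⁴ ∖ 0} G(quatCoord e ξ)` for every `G ≥ 0`;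
* §4 `exists_tsum_coord_tail_le_exp` — the bound in coordinates; §5 the heads `thetaTail_le_exp` (all `t`, all `κ > 1`), `thetaTail_plus` ((H3⁺) bytes of ★
  `K2E5QuatZetaAbsConvOfThetaBounds`, rate `σ + 1` for `σ > 0`), `thetaTail_minus_of_lt` (contracting side at any rate `κ ∈ (1, ∞)`).

HONEST LABEL.  HC_CM is proved only modulo the 7 printed citations (2 remaining named inputs: hLiu418 = `stmt-HodgeConjecture-24832`, h413 =
`stmt-HodgeConjecture-24833`) until rung 0 closes; this file is a `--supports stmt-HodgeConjecture-24833 --as helper` payment and moves no counter.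

## References
* [WeilBNT1967] A. Weil, *Basic Number Theory* (1967), Ch. VII §5 Prop. 11, §6 (zeta integrals of simple algebras; theta estimates).
* [VignerasLNM800] M.-F. Vignéras, *Arithmétique des algèbres de quaternions*, LNM 800 (1980), Ch. III §2, proof of Thm. 2.2.
* [GodementJacquetLNM260] R. Godement, H. Jacquet, *Zeta functions of simple algebras*, LNM 260 (1972), §11 Lemmas 11.5–11.6.
* [TateThesis1967] J. Tate, *Fourier analysis in number fields and Hecke's zeta functions*, in Cassels–Fröhlich (1967), §4.4.
-/

set_option autoImplicit false
-- the mandated namespace repeats the single-problem summit's segment (`HodgeConjecture.HodgeConjecture`)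
set_option linter.dupNamespace false

noncomputable section

namespace Summit.HodgeConjecture.HodgeConjecture.Cruxes.H413.K2E5QuatThetaBounds

open NumberField IsDedekindDomain MeasureTheory Filter Topology Set
open scoped Matrix MatrixGroups NNReal ENNReal
open Literature.NumberTheory.Automorphic
open Summit.HodgeConjecture.HodgeConjecture.Cruxes.H413.K2E5QuatAdelicMatrixModel
open Summit.HodgeConjecture.HodgeConjecture.Cruxes.H413.K2E5QuatZeta
open Summit.HodgeConjecture.HodgeConjecture.Cruxes.H413.K2E5QuatAdelicCoordinates
open Summit.HodgeConjecture.HodgeConjecture.Cruxes.H413.K2E5QuatAdelicNrd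
open Summit.HodgeConjecture.HodgeConjecture.Cruxes.H413.K2E5QuatAdelicRat
open Summit.HodgeConjecture.HodgeConjecture.Cruxes.H413.K2E5QuatAdelicLattice
open Summit.HodgeConjecture.HodgeConjecture.Cruxes.H413.K2E5QuatAdelicModuleOne
open Summit.HodgeConjecture.HodgeConjecture.Cruxes.H413.K2E5QuatPoissonTransport

variable (L : Type) [Field L] [NumberField L] [IsCMField L] {Ha : Matrix (Fin 2) (Fin 2) L}
  (hHa : (Ha.map (cmConjRingHom L)).transpose = Ha) (hdet : Ha.det ≠ 0)

open Summit.HodgeConjecture.HodgeConjecture.Cruxes.H413.K2E5QuatLeftMul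

/-! ## §3 The lattice `Γ_h = D_h^×` injects into the non-zero rational coordinate vectors -/

section Lattice

/-- **Every `γ ∈ Γ_h` is `quatCoord e (ξ ⊗ 1)` for a unique NON-ZERO `ξ ∈ K⁴`, injectively in `γ`**: an injection `ι : Γ_h → K⁴ ∖ 0` with
`quatCoord e (ratVec (ι γ)) = γ` as matrices (★ `mem_quatRatLattice_iff_exists`, the basis `quatBasis`, ★ `map_sum_smul_quatBasis_eq_quatCoord`, ★ `toAdeleGL_injective`).
[cite: VignerasLNM800, Ch. III §1 (X_K ↪ X_A sur une base)] -/
theorem exists_coord_injection :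
    ∃ ι : ↥(quatRatLatticeOne L Ha) → {v : Fin 4 → ↥(maximalRealSubfield L) // v ≠ 0}, Function.Injective ι ∧
      ∀ γ : ↥(quatRatLatticeOne L Ha),
        quatCoord L (fun i => ((quatBasis L Ha hHa hdet i : ↥(quatRatSubalgebra L Ha)) : Matrix (Fin 2) (Fin 2) L))
            (ratVec (↥(maximalRealSubfield L)) ((ι γ : {v : Fin 4 → ↥(maximalRealSubfield L) // v ≠ 0}) : Fin 4 → ↥(maximalRealSubfield L))) =
          ((((γ : ↥(quatAdelicUnitsOne L Ha)) : ↥(quatAdelicUnits L Ha)) : GL (Fin 2) (AdeleRing (𝓞 L) L)) : Matrix (Fin 2) (Fin 2) (AdeleRing (𝓞 L) L)) := by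
  classical
  -- the rational matrix `γ₀ ∈ D_h(L⁺)^×` under `γ`
  have hex : ∀ γ : ↥(quatRatLatticeOne L Ha), ∃ γ₀ ∈ quatRatUnits L Ha,
      toAdeleGL L γ₀ = (((γ : ↥(quatAdelicUnitsOne L Ha)) : ↥(quatAdelicUnits L Ha)) : GL (Fin 2) (AdeleRing (𝓞 L) L)) := fun γ =>
    (mem_quatRatLattice_iff_exists L Ha _).1 ((mem_quatRatLatticeOne_iff L Ha _).1 γ.2)
  choose γ₀ hγ₀ hγ₀eq using hex
  -- its coordinates on `quatBasis`
  have hmem : ∀ γ, ((γ₀ γ : GL (Fin 2) L) : Matrix (Fin 2) (Fin 2) L) ∈ quatRatSubalgebra L Ha := fun γ =>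
    (mem_quatRatUnits_iff L Ha _).1 (hγ₀ γ)
  set ξ : ↥(quatRatLatticeOne L Ha) → (Fin 4 → ↥(maximalRealSubfield L)) := fun γ =>
    (quatBasis L Ha hHa hdet).equivFun ⟨_, hmem γ⟩ with hξ
  have hsum : ∀ γ, (∑ i, (ξ γ i : L) • ((quatBasis L Ha hHa hdet i : ↥(quatRatSubalgebra L Ha)) : Matrix (Fin 2) (Fin 2) L)) =
      ((γ₀ γ : GL (Fin 2) L) : Matrix (Fin 2) (Fin 2) L) := by
    intro γ
    rw [← coe_equivFun_symm_quatBasis L hHa hdet (ξ γ), hξ, LinearEquiv.symm_apply_apply]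
  have hcoord : ∀ γ, quatCoord L (fun i => ((quatBasis L Ha hHa hdet i : ↥(quatRatSubalgebra L Ha)) : Matrix (Fin 2) (Fin 2) L))
      (ratVec (↥(maximalRealSubfield L)) (ξ γ)) =
      ((((γ : ↥(quatAdelicUnitsOne L Ha)) : ↥(quatAdelicUnits L Ha)) : GL (Fin 2) (AdeleRing (𝓞 L) L)) : Matrix (Fin 2) (Fin 2) (AdeleRing (𝓞 L) L)) := by
    intro γ
    have hrv : ratVec (↥(maximalRealSubfield L)) (ξ γ) = fun i => algebraMap _ _ (ξ γ i) := rfl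
    rw [hrv, ← map_sum_smul_quatBasis_eq_quatCoord L hHa hdet, hsum, ← val_toAdeleGL, hγ₀eq]
  have hne : ∀ γ, ξ γ ≠ 0 := by
    intro γ h0
    have hmat : ((γ₀ γ : GL (Fin 2) L) : Matrix (Fin 2) (Fin 2) L) = 0 := by
      rw [← hsum γ, h0]
      simp
    exact (Matrix.GeneralLinearGroup.det_ne_zero (γ₀ γ)) (by rw [hmat]; exact Matrix.det_zero)
  refine ⟨fun γ => ⟨ξ γ, hne γ⟩, ?_, fun γ => hcoord γ⟩
  intro γ γ' h
  have hξeq : ξ γ = ξ γ' := congrArg Subtype.val h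
  have hm : ((((γ : ↥(quatAdelicUnitsOne L Ha)) : ↥(quatAdelicUnits L Ha)) : GL (Fin 2) (AdeleRing (𝓞 L) L)) : Matrix (Fin 2) (Fin 2) (AdeleRing (𝓞 L) L)) =
      ((((γ' : ↥(quatAdelicUnitsOne L Ha)) : ↥(quatAdelicUnits L Ha)) : GL (Fin 2) (AdeleRing (𝓞 L) L)) : Matrix (Fin 2) (Fin 2) (AdeleRing (𝓞 L) L)) := by
    rw [← hcoord γ, ← hcoord γ', hξeq]
  exact Subtype.ext (Subtype.ext (Subtype.ext (Units.ext hm)))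

/-- **Theta sums over `Γ_h` are dominated by theta sums over the non-zero coordinate vectors**: for every `G ≥ 0` on `M₂(𝔸_L)`,
`Σ_{γ ∈ Γ_h} G(γ) ≤ Σ_{ξ ∈ K⁴, ξ ≠ 0} G(quatCoord e (ξ ⊗ 1))` (Mathlib `ENNReal.tsum_comp_le_tsum_of_injective` along `exists_coord_injection`).
[cite: VignerasLNM800, Ch. III §2 (X_K^• ⊂ X_K = K-points summed on a basis)] [cite: WeilBNT1967, Ch. VII §5] -/
theorem tsum_quatRatLatticeOne_le_tsum_coord (G : Matrix (Fin 2) (Fin 2) (AdeleRing (𝓞 L) L) → ℝ≥0∞) :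
    (∑' γ : ↥(quatRatLatticeOne L Ha),
        G ((((γ : ↥(quatAdelicUnitsOne L Ha)) : ↥(quatAdelicUnits L Ha)) : GL (Fin 2) (AdeleRing (𝓞 L) L)) : Matrix (Fin 2) (Fin 2) (AdeleRing (𝓞 L) L))) ≤
      ∑' v : {v : Fin 4 → ↥(maximalRealSubfield L) // v ≠ 0},
        G (quatCoord L (fun i => ((quatBasis L Ha hHa hdet i : ↥(quatRatSubalgebra L Ha)) : Matrix (Fin 2) (Fin 2) L))
          (ratVec (↥(maximalRealSubfield L)) (v : Fin 4 → ↥(maximalRealSubfield L)))) := by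
  obtain ⟨ι, hι, hιγ⟩ := exists_coord_injection L hHa hdet
  calc (∑' γ : ↥(quatRatLatticeOne L Ha),
        G ((((γ : ↥(quatAdelicUnitsOne L Ha)) : ↥(quatAdelicUnits L Ha)) : GL (Fin 2) (AdeleRing (𝓞 L) L)) : Matrix (Fin 2) (Fin 2) (AdeleRing (𝓞 L) L)))
      = ∑' γ : ↥(quatRatLatticeOne L Ha),
          G (quatCoord L (fun i => ((quatBasis L Ha hHa hdet i : ↥(quatRatSubalgebra L Ha)) : Matrix (Fin 2) (Fin 2) L))
            (ratVec (↥(maximalRealSubfield L)) ((ι γ : {v : Fin 4 → ↥(maximalRealSubfield L) // v ≠ 0}) : Fin 4 → ↥(maximalRealSubfield L)))) :=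
        tsum_congr fun γ => by rw [hιγ]
    _ ≤ _ := ENNReal.tsum_comp_le_tsum_of_injective hι
        (fun v : {v : Fin 4 → ↥(maximalRealSubfield L) // v ≠ 0} =>
          G (quatCoord L (fun i => ((quatBasis L Ha hHa hdet i : ↥(quatRatSubalgebra L Ha)) : Matrix (Fin 2) (Fin 2) L))
            (ratVec (↥(maximalRealSubfield L)) (v : Fin 4 → ↥(maximalRealSubfield L)))))

end Lattice

/-! ## §4 The theta tail bound in coordinates -/

section Tail

/-- **THE THETA TAIL BOUND IN COORDINATES.**  For `Φ ∈ quatSchwartzBruhat`, a COMPACT `K ⊆ (D_h ⊗ 𝔸)^×` and `κ > 1` there is `B < ∞` with, for all `y ∈ K` and all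
`s ∈ ℝ_{>0}`: `Σ_{ξ ∈ K⁴ ∖ 0} ‖Φ(y · z_s · quatCoord e (ξ ⊗ 1))‖ ≤ B · s^{−4dκ}`, `z_s` the scalar `posRealIdele K s` (★ tail-ray decay at `L = M(y)`, `r = s⁻¹`,
`θ = 4dκ`, decay order `⌈θ⌉₊`). [cite: GodementJacquetLNM260, §11 Lemma 11.6] [cite: WeilBNT1967, Ch. VII §5 Prop. 11] -/
theorem exists_tsum_coord_tail_le_rpow {Φ : Matrix (Fin 2) (Fin 2) (AdeleRing (𝓞 L) L) → ℂ}
    (hΦ : Φ ∈ quatSchwartzBruhat L (fun i => ((quatBasis L Ha hHa hdet i : ↥(quatRatSubalgebra L Ha)) : Matrix (Fin 2) (Fin 2) L)))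
    {K : Set ↥(quatAdelicUnits L Ha)} (hK : IsCompact K) {κ : ℝ} (hκ : 1 < κ) :
    ∃ B : ℝ≥0∞, B ≠ ⊤ ∧ ∀ y ∈ K, ∀ s : ℝ≥0ˣ,
      (∑' v : {v : Fin 4 → ↥(maximalRealSubfield L) // v ≠ 0},
          ‖Φ (((y : GL (Fin 2) (AdeleRing (𝓞 L) L)) : Matrix (Fin 2) (Fin 2) (AdeleRing (𝓞 L) L)) *
              quatCoord L (fun i => ((quatBasis L Ha hHa hdet i : ↥(quatRatSubalgebra L Ha)) : Matrix (Fin 2) (Fin 2) L))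
                (((posRealIdele ↥(maximalRealSubfield L) s : (AdeleRing (𝓞 ↥(maximalRealSubfield L)) ↥(maximalRealSubfield L))ˣ) :
                    AdeleRing (𝓞 ↥(maximalRealSubfield L)) ↥(maximalRealSubfield L)) •
                  ratVec (↥(maximalRealSubfield L)) (v : Fin 4 → ↥(maximalRealSubfield L))))‖ₑ) ≤
        B * ENNReal.ofReal (((s : ℝ≥0) : ℝ) ^ (-(4 * (Module.finrank ℚ ↥(maximalRealSubfield L) : ℝ) * κ))) := by
  -- abbreviations
  set d : ℕ := Module.finrank ℚ ↥(maximalRealSubfield L) with hd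
  have hd0 : 0 < d := Module.finrank_pos
  set θ : ℝ := 4 * (d : ℝ) * κ with hθ
  have hθN : ((4 : ℕ) : ℝ) * Module.finrank ℚ ↥(maximalRealSubfield L) < θ := by
    rw [hθ]
    have : (4 : ℝ) * (d : ℝ) * 1 < 4 * (d : ℝ) * κ := mul_lt_mul_of_pos_left hκ (by positivity)
    simpa [hd] using this
  have hθ0 : 0 ≤ θ := by rw [hθ]; positivity
  set k : ℕ := ⌈θ⌉₊ with hk
  have hθk : θ ≤ k := Nat.le_ceil θ
  -- `Ψ = Φ ∘ quatCoord e` is Schwartz–Bruhat on `𝔸_K⁴`: decay of order `k`, finite support in a compact `C_f`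
  have hΨ : (fun a => Φ (quatCoord L (fun i => ((quatBasis L Ha hHa hdet i : ↥(quatRatSubalgebra L Ha)) : Matrix (Fin 2) (Fin 2) L)) a)) ∈ piSchwartzBruhat ↥(maximalRealSubfield L) (Fin 4) := (mem_quatSchwartzBruhat_iff L _ Φ).1 hΦ
  obtain ⟨M₀, hM₀, Cf, hCfc, hdecay, hsupp⟩ := exists_decay_of_mem_piSchwartzBruhat (K := ↥(maximalRealSubfield L)) hΨ k
  -- the left-multiplication matrices of `K` have compact finite parts and bounded archimedean height
  have hKM : IsCompact (leftMulGL L hHa hdet '' K) := hK.image (continuous_leftMulGL L hHa hdet)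
  set 𝒴 : Set (GL (Fin 4) (FiniteAdeleRing (𝓞 ↥(maximalRealSubfield L)) ↥(maximalRealSubfield L))) := GLn.sndHom 4 ↥(maximalRealSubfield L) '' (leftMulGL L hHa hdet '' K) with h𝒴
  have h𝒴c : IsCompact 𝒴 := hKM.image GLn.continuous_sndHom
  obtain ⟨H₀, hH₀⟩ := (hKM.image GLn.continuous_archHeight).bddAbove
  -- ★ the tail of the theta sum decays along the ray, uniformly for `L_f ∈ 𝒴`
  obtain ⟨B, hBtop, hB⟩ := exists_tsum_enorm_vecMul_tail_ray_le_archHeight_rpow ↥(maximalRealSubfield L) (N := 4) hM₀ hdecay hCfc hsupp h𝒴c hθN hθk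
  set B' : ℝ≥0∞ := B * ENNReal.ofReal ((max 1 (((4 : ℕ) : ℝ) ^ 2 * H₀)) ^ θ) with hB'
  refine ⟨B', ENNReal.mul_ne_top hBtop ENNReal.ofReal_ne_top, fun y hy s => ?_⟩
  have hy𝒴 : GLn.sndHom 4 ↥(maximalRealSubfield L) (leftMulGL L hHa hdet y) ∈ 𝒴 := ⟨_, ⟨y, hy, rfl⟩, rfl⟩
  have hHy : (GLn.archHeight 4 ↥(maximalRealSubfield L) (leftMulGL L hHa hdet y) : ℝ) ≤ H₀ := by
    exact_mod_cast hH₀ ⟨_, ⟨y, hy, rfl⟩, rfl⟩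
  have hray := hB (leftMulGL L hHa hdet y) hy𝒴 s⁻¹
  -- rewrite the summands: `y · quatCoord e (c • ξ) = quatCoord e (ξ ᵥ* (M(y) · z_s))`, `z_s = (z_{s⁻¹})⁻¹`
  have hsummand : ∀ v : {v : Fin 4 → ↥(maximalRealSubfield L) // v ≠ 0},
      Φ (((y : GL (Fin 2) (AdeleRing (𝓞 L) L)) : Matrix (Fin 2) (Fin 2) (AdeleRing (𝓞 L) L)) *
          quatCoord L (fun i => ((quatBasis L Ha hHa hdet i : ↥(quatRatSubalgebra L Ha)) : Matrix (Fin 2) (Fin 2) L)) (((posRealIdele ↥(maximalRealSubfield L) s : (AdeleRing (𝓞 ↥(maximalRealSubfield L)) ↥(maximalRealSubfield L))ˣ) : AdeleRing (𝓞 ↥(maximalRealSubfield L)) ↥(maximalRealSubfield L)) • ratVec ↥(maximalRealSubfield L) (v : Fin 4 → ↥(maximalRealSubfield L)))) =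
        Φ (quatCoord L (fun i => ((quatBasis L Ha hHa hdet i : ↥(quatRatSubalgebra L Ha)) : Matrix (Fin 2) (Fin 2) L)) (ratVec ↥(maximalRealSubfield L) (v : Fin 4 → ↥(maximalRealSubfield L)) ᵥ*
          ((leftMulGL L hHa hdet y * (posRealScalar 4 ↥(maximalRealSubfield L) s⁻¹)⁻¹ : GL (Fin 4) (AdeleRing (𝓞 ↥(maximalRealSubfield L)) ↥(maximalRealSubfield L))) : Matrix (Fin 4) (Fin 4) (AdeleRing (𝓞 ↥(maximalRealSubfield L)) ↥(maximalRealSubfield L))))) := by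
    intro v
    rw [coe_mul_quatCoord_eq, smul_vecMul_eq_vecMul_mul_posRealScalar, map_inv, inv_inv, Units.val_mul]
  rw [tsum_congr fun v => congrArg (fun z : ℂ => (‖z‖ₑ : ℝ≥0∞)) (hsummand v)]
  refine hray.trans ?_
  -- compare the constants: `(s⁻¹)^θ = s^{-θ}` and `H_∞(M y) ≤ H₀`
  have hr : ENNReal.ofReal ((((s⁻¹ : ℝ≥0ˣ) : ℝ≥0) : ℝ) ^ θ) = ENNReal.ofReal (((s : ℝ≥0) : ℝ) ^ (-(4 * (Module.finrank ℚ ↥(maximalRealSubfield L) : ℝ) * κ))) := by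
    rw [Units.val_inv_eq_inv_val, NNReal.coe_inv, Real.inv_rpow (NNReal.coe_nonneg _), ← Real.rpow_neg (NNReal.coe_nonneg _), hθ, hd]
  rw [hr]
  have hP : (max 1 (((4 : ℕ) : ℝ) ^ 2 * (GLn.archHeight 4 ↥(maximalRealSubfield L) (leftMulGL L hHa hdet y) : ℝ))) ^ θ ≤ (max 1 (((4 : ℕ) : ℝ) ^ 2 * H₀)) ^ θ :=
    Real.rpow_le_rpow (le_trans zero_le_one (le_max_left _ _)) (max_le_max le_rfl (mul_le_mul_of_nonneg_left hHy (by positivity))) hθ0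
  calc ENNReal.ofReal (((s : ℝ≥0) : ℝ) ^ (-(4 * (Module.finrank ℚ ↥(maximalRealSubfield L) : ℝ) * κ))) *
        (B * ENNReal.ofReal ((max 1 (((4 : ℕ) : ℝ) ^ 2 * (GLn.archHeight 4 ↥(maximalRealSubfield L) (leftMulGL L hHa hdet y) : ℝ))) ^ θ))
      = B * ENNReal.ofReal ((max 1 (((4 : ℕ) : ℝ) ^ 2 * (GLn.archHeight 4 ↥(maximalRealSubfield L) (leftMulGL L hHa hdet y) : ℝ))) ^ θ) *
          ENNReal.ofReal (((s : ℝ≥0) : ℝ) ^ (-(4 * (Module.finrank ℚ ↥(maximalRealSubfield L) : ℝ) * κ))) := by ring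
    _ ≤ B * ENNReal.ofReal ((max 1 (((4 : ℕ) : ℝ) ^ 2 * H₀)) ^ θ) * ENNReal.ofReal (((s : ℝ≥0) : ℝ) ^ (-(4 * (Module.finrank ℚ ↥(maximalRealSubfield L) : ℝ) * κ))) := by
        gcongr

end Tail

/-! ## §5 The heads: theta sums over `Γ_h` along the central section, in the form consumed by ★ `K2E5QuatZetaAbsConvOfThetaBounds` -/

section Heads

omit [IsCMField L] in
/-- The real exponent bookkeeping: for `τ = e^t` and `s = τ^{1∕4d}`, `s^{−4dκ} = e^{−κ t}`. [folklore] -/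
theorem rpow_section_parameter (κ t : ℝ) :
    (((Units.map (NNReal.rpowMonoidHom ((4 * Module.finrank ℚ ↥(maximalRealSubfield L) : ℕ) : ℝ)⁻¹)
        (Units.mk0 (Real.toNNReal (Real.exp t)) (Real.toNNReal_pos.2 (Real.exp_pos t)).ne') : ℝ≥0ˣ) : ℝ≥0) : ℝ) ^
        (-(4 * (Module.finrank ℚ ↥(maximalRealSubfield L) : ℝ) * κ)) = Real.exp (-κ * t) := by
  have hd : (Module.finrank ℚ ↥(maximalRealSubfield L) : ℝ) ≠ 0 := by exact_mod_cast Module.finrank_pos.ne'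
  rw [coe_unitsMap_rpowMonoidHom, NNReal.coe_rpow, Units.val_mk0, Real.coe_toNNReal _ (Real.exp_pos t).le,
    ← Real.rpow_mul (Real.exp_pos t).le, ← Real.exp_mul]
  congr 1
  push_cast
  field_simp

/-- **THE HEAD `thetaTail_le_exp` — THETA SUMS OVER `Γ_h` ALONG THE CENTRAL RAY, BOTH SIDES, EVERY RATE `κ > 1`.**  For a non-degenerate hermitian plane `h` over
a CM field `L`, a COMPACT `K ⊆ D^{(1)}_{h,𝔸}`, `Φ ∈ quatSchwartzBruhat` and `κ > 1` there is `B < ∞` with, for every `y ∈ K` and EVERY real `t`: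
`Σ_{γ ∈ Γ_h} ‖Φ(y γ θ_{e^t})‖ ≤ B · e^{−κ t}` (summand VERBATIM as in ★ `K2E5QuatZetaAbsConvOfThetaBounds`; `θ_{e^t} = quatModuleSection (e^t)`).  For `t > 0`: decay at any
rate (`κ = σ + 1` is (H3⁺)); for `t ≤ 0`: growth `e^{κ|t|}` with `κ ↓ 1` — the crude contracting bound (the sharp `e^{|t|}` is Poisson, not claimed).
Proof: `y γ θ = (y θ) γ` (θ central), §3 comparison with the coordinate lattice, §2 the ray in coordinates, §4 the ★ tail-ray decay.
[cite: WeilBNT1967, Ch. VII §5 Prop. 11, §6] [cite: VignerasLNM800, Ch. III §2 (proof of Thm. 2.2)] [cite: GodementJacquetLNM260, §11 Lemma 11.6] -/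
theorem thetaTail_le_exp {K : Set ↥(quatAdelicUnitsOne L Ha)} (hK : IsCompact K)
    {Φ : Matrix (Fin 2) (Fin 2) (AdeleRing (𝓞 L) L) → ℂ}
    (hΦ : Φ ∈ quatSchwartzBruhat L (fun i => ((quatBasis L Ha hHa hdet i : ↥(quatRatSubalgebra L Ha)) : Matrix (Fin 2) (Fin 2) L))) {κ : ℝ} (hκ : 1 < κ) :
    ∃ B : ℝ≥0∞, B ≠ ⊤ ∧ ∀ y ∈ K, ∀ t : ℝ,
      (∑' γ : ↥(quatRatLatticeOne L Ha), ‖Φ (((((y * γ : ↥(quatAdelicUnitsOne L Ha)) : ↥(quatAdelicUnits L Ha)) *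
          quatModuleSection L Ha (Units.mk0 (Real.toNNReal (Real.exp t)) (Real.toNNReal_pos.2 (Real.exp_pos t)).ne') :
            GL (Fin 2) (AdeleRing (𝓞 L) L)) : Matrix (Fin 2) (Fin 2) (AdeleRing (𝓞 L) L)))‖ₑ) ≤ B * ENNReal.ofReal (Real.exp (-κ * t)) := by
  -- the image of `K` in `(D_h ⊗ 𝔸)^×` is compact
  have hK' : IsCompact ((fun y : ↥(quatAdelicUnitsOne L Ha) => (y : ↥(quatAdelicUnits L Ha))) '' K) := hK.image continuous_subtype_val
  obtain ⟨B, hB, hbound⟩ := exists_tsum_coord_tail_le_rpow L hHa hdet hΦ hK' hκ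
  refine ⟨B, hB, fun y hy t => ?_⟩
  -- the summand: `(y γ) θ = (y θ) γ` as matrices (θ is central)
  have hcomm : ∀ γ : ↥(quatRatLatticeOne L Ha), (((((y * γ : ↥(quatAdelicUnitsOne L Ha)) : ↥(quatAdelicUnits L Ha)) * quatModuleSection L Ha (Units.mk0 (Real.toNNReal (Real.exp t)) (Real.toNNReal_pos.2 (Real.exp_pos t)).ne') : ↥(quatAdelicUnits L Ha)) : GL (Fin 2) (AdeleRing (𝓞 L) L)) : Matrix (Fin 2) (Fin 2) (AdeleRing (𝓞 L) L)) = (((y : ↥(quatAdelicUnits L Ha)) : GL (Fin 2) (AdeleRing (𝓞 L) L)) : Matrix (Fin 2) (Fin 2) (AdeleRing (𝓞 L) L)) * (((quatModuleSection L Ha (Units.mk0 (Real.toNNReal (Real.exp t)) (Real.toNNReal_pos.2 (Real.exp_pos t)).ne') : ↥(quatAdelicUnits L Ha)) : GL (Fin 2) (AdeleRing (𝓞 L) L)) : Matrix (Fin 2) (Fin 2) (AdeleRing (𝓞 L) L)) * ((((γ : ↥(quatAdelicUnitsOne L Ha)) : ↥(quatAdelicUnits L Ha)) : GL (Fin 2)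 (AdeleRing (𝓞 L) L)) : Matrix (Fin 2) (Fin 2) (AdeleRing (𝓞 L) L)) := by
    intro γ
    have h1 : ((y * γ : ↥(quatAdelicUnitsOne L Ha)) : ↥(quatAdelicUnits L Ha)) * quatModuleSection L Ha (Units.mk0 (Real.toNNReal (Real.exp t)) (Real.toNNReal_pos.2 (Real.exp_pos t)).ne') =
        (y : ↥(quatAdelicUnits L Ha)) * quatModuleSection L Ha (Units.mk0 (Real.toNNReal (Real.exp t)) (Real.toNNReal_pos.2 (Real.exp_pos t)).ne') * ((γ : ↥(quatAdelicUnitsOne L Ha)) : ↥(quatAdelicUnits L Ha)) := by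
      rw [Subgroup.coe_mul, mul_assoc, ← quatModuleSection_mul_comm, ← mul_assoc]
    rw [h1, Subgroup.coe_mul, Subgroup.coe_mul, Units.val_mul, Units.val_mul]
  -- the ray in coordinates (§2)
  have hray : ∀ v : {v : Fin 4 → ↥(maximalRealSubfield L) // v ≠ 0},
      (((y : ↥(quatAdelicUnits L Ha)) : GL (Fin 2) (AdeleRing (𝓞 L) L)) : Matrix (Fin 2) (Fin 2) (AdeleRing (𝓞 L) L)) * (((quatModuleSection L Ha (Units.mk0 (Real.toNNReal (Real.exp t)) (Real.toNNReal_pos.2 (Real.exp_pos t)).ne') : ↥(quatAdelicUnits L Ha)) : GL (Fin 2) (AdeleRing (𝓞 L) L)) : Matrix (Fin 2) (Fin 2) (AdeleRing (𝓞 L) L)) * quatCoord L (fun i => ((quatBasis L Ha hHa hdet i : ↥(quatRatSubalgebra L Ha)) : Matrix (Fin 2) (Fin 2) L)) (ratVec ↥(maximalRealSubfield L) (v : Fin 4 → ↥(maximalRealSubfield L))) =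
        (((y : ↥(quatAdelicUnits L Ha)) : GL (Fin 2) (AdeleRing (𝓞 L) L)) : Matrix (Fin 2) (Fin 2) (AdeleRing (𝓞 L) L)) * quatCoord L (fun i => ((quatBasis L Ha hHa hdet i : ↥(quatRatSubalgebra L Ha)) : Matrix (Fin 2) (Fin 2) L)) (((posRealIdele ↥(maximalRealSubfield L) (Units.map (NNReal.rpowMonoidHom ((4 * Module.finrank ℚ ↥(maximalRealSubfield L) : ℕ) : ℝ)⁻¹) (Units.mk0 (Real.toNNReal (Real.exp t)) (Real.toNNReal_pos.2 (Real.exp_pos t)).ne')) : (AdeleRing (𝓞 ↥(maximalRealSubfield L)) ↥(maximalRealSubfield L))ˣ) : AdeleRing (𝓞 ↥(maximalRealSubfield L)) ↥(maximalRealSubfield L)) • ratVec ↥(maximalRealSubfield L) (v : Fin 4 → ↥(maximalRealSubfield L))) := by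
    intro v
    rw [Matrix.mul_assoc, coe_quatModuleSection_mul_quatCoord]
  calc (∑' γ : ↥(quatRatLatticeOne L Ha), ‖Φ (((((y * γ : ↥(quatAdelicUnitsOne L Ha)) : ↥(quatAdelicUnits L Ha)) * quatModuleSection L Ha (Units.mk0 (Real.toNNReal (Real.exp t)) (Real.toNNReal_pos.2 (Real.exp_pos t)).ne') : ↥(quatAdelicUnits L Ha)) : GL (Fin 2) (AdeleRing (𝓞 L) L)) : Matrix (Fin 2) (Fin 2) (AdeleRing (𝓞 L) L))‖ₑ)
      = ∑' γ : ↥(quatRatLatticeOne L Ha), ‖Φ ((((y : ↥(quatAdelicUnits L Ha)) : GL (Fin 2) (AdeleRing (𝓞 L) L)) : Matrix (Fin 2) (Fin 2) (AdeleRing (𝓞 L) L)) * (((quatModuleSection L Ha (Units.mk0 (Real.toNNReal (Real.exp t)) (Real.toNNReal_pos.2 (Real.exp_pos t)).ne') : ↥(quatAdelicUnits L Ha)) : GL (Fin 2) (AdeleRing (𝓞 L) L)) : Matrix (Fin 2) (Fin 2) (AdeleRing (𝓞 L) L)) * ((((γ : ↥(quatAdelicUnitsOne L Ha)) : ↥(quatAdelicUnits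 L Ha)) : GL (Fin 2) (AdeleRing (𝓞 L) L)) : Matrix (Fin 2) (Fin 2) (AdeleRing (𝓞 L) L)))‖ₑ := tsum_congr fun γ => by rw [hcomm γ]
    _ ≤ ∑' v : {v : Fin 4 → ↥(maximalRealSubfield L) // v ≠ 0}, ‖Φ ((((y : ↥(quatAdelicUnits L Ha)) : GL (Fin 2) (AdeleRing (𝓞 L) L)) : Matrix (Fin 2) (Fin 2) (AdeleRing (𝓞 L) L)) * (((quatModuleSection L Ha (Units.mk0 (Real.toNNReal (Real.exp t)) (Real.toNNReal_pos.2 (Real.exp_pos t)).ne') : ↥(quatAdelicUnits L Ha)) : GL (Fin 2) (AdeleRing (𝓞 L) L)) : Matrix (Fin 2) (Fin 2) (AdeleRing (𝓞 L) L)) * quatCoord L (fun i => ((quatBasis L Ha hHa hdet i : ↥(quatRatSubalgebra L Ha)) : Matrix (Fin 2) (Fin 2) L)) (ratVec ↥(maximalRealSubfield L) (v : Fin 4 → ↥(maximalRealSubfield L))))‖ₑ :=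
        tsum_quatRatLatticeOne_le_tsum_coord L hHa hdet (fun X => ‖Φ ((((y : ↥(quatAdelicUnits L Ha)) : GL (Fin 2) (AdeleRing (𝓞 L) L)) : Matrix (Fin 2) (Fin 2) (AdeleRing (𝓞 L) L)) * (((quatModuleSection L Ha (Units.mk0 (Real.toNNReal (Real.exp t)) (Real.toNNReal_pos.2 (Real.exp_pos t)).ne') : ↥(quatAdelicUnits L Ha)) : GL (Fin 2) (AdeleRing (𝓞 L) L)) : Matrix (Fin 2) (Fin 2) (AdeleRing (𝓞 L) L)) * X)‖ₑ)
    _ = ∑' v : {v : Fin 4 → ↥(maximalRealSubfield L) // v ≠ 0}, ‖Φ ((((y : ↥(quatAdelicUnits L Ha)) : GL (Fin 2) (AdeleRing (𝓞 L) L)) : Matrix (Fin 2) (Fin 2) (AdeleRing (𝓞 L) L)) * quatCoord L (fun i => ((quatBasis L Ha hHa hdet i : ↥(quatRatSubalgebra L Ha)) : Matrix (Fin 2) (Fin 2) L)) (((posRealIdele ↥(maximalRealSubfield L) (Units.map (NNReal.rpowMonoidHom ((4 * Module.finrank ℚ ↥(maximalRealSubfield L) : ℕ) : ℝ)⁻¹)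 (Units.mk0 (Real.toNNReal (Real.exp t)) (Real.toNNReal_pos.2 (Real.exp_pos t)).ne')) : (AdeleRing (𝓞 ↥(maximalRealSubfield L)) ↥(maximalRealSubfield L))ˣ) : AdeleRing (𝓞 ↥(maximalRealSubfield L)) ↥(maximalRealSubfield L)) • ratVec ↥(maximalRealSubfield L) (v : Fin 4 → ↥(maximalRealSubfield L))))‖ₑ :=
        tsum_congr fun v => by rw [hray v]
    _ ≤ B * ENNReal.ofReal (((((Units.map (NNReal.rpowMonoidHom ((4 * Module.finrank ℚ ↥(maximalRealSubfield L) : ℕ) : ℝ)⁻¹) (Units.mk0 (Real.toNNReal (Real.exp t)) (Real.toNNReal_pos.2 (Real.exp_pos t)).ne')) : ℝ≥0ˣ) : ℝ≥0) : ℝ) ^ (-(4 * (Module.finrank ℚ ↥(maximalRealSubfield L) : ℝ) * κ))) :=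
        hbound (y : ↥(quatAdelicUnits L Ha)) ⟨y, hy, rfl⟩ (Units.map (NNReal.rpowMonoidHom ((4 * Module.finrank ℚ ↥(maximalRealSubfield L) : ℕ) : ℝ)⁻¹) (Units.mk0 (Real.toNNReal (Real.exp t)) (Real.toNNReal_pos.2 (Real.exp_pos t)).ne'))
    _ = B * ENNReal.ofReal (Real.exp (-κ * t)) := by rw [rpow_section_parameter]

/-- **(H3⁺) OF ★ `K2E5QuatZetaAbsConvOfThetaBounds` — the expanding side at rate `σ + 1`** (for every `σ > 0`; the consumer has `σ > 1`): bytes of the hypothesis `hplus`.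
[cite: VignerasLNM800, Ch. III §2] [cite: TateThesis1967, §4.4] -/
theorem thetaTail_plus {K : Set ↥(quatAdelicUnitsOne L Ha)} (hK : IsCompact K)
    {Φ : Matrix (Fin 2) (Fin 2) (AdeleRing (𝓞 L) L) → ℂ}
    (hΦ : Φ ∈ quatSchwartzBruhat L (fun i => ((quatBasis L Ha hHa hdet i : ↥(quatRatSubalgebra L Ha)) : Matrix (Fin 2) (Fin 2) L))) {σ : ℝ} (hσ : 0 < σ) :
    ∃ B : ℝ≥0∞, B ≠ ⊤ ∧ ∀ y ∈ K, ∀ t : ℝ, 0 < t →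
      (∑' γ : ↥(quatRatLatticeOne L Ha), ‖Φ (((((y * γ : ↥(quatAdelicUnitsOne L Ha)) : ↥(quatAdelicUnits L Ha)) *
          quatModuleSection L Ha (Units.mk0 (Real.toNNReal (Real.exp t)) (Real.toNNReal_pos.2 (Real.exp_pos t)).ne') :
            GL (Fin 2) (AdeleRing (𝓞 L) L)) : Matrix (Fin 2) (Fin 2) (AdeleRing (𝓞 L) L)))‖ₑ) ≤ B * ENNReal.ofReal (Real.exp (-(σ + 1) * t)) := by
  obtain ⟨B, hB, h⟩ := thetaTail_le_exp L hHa hdet hK hΦ (κ := σ + 1) (by linarith)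
  exact ⟨B, hB, fun y hy t _ => h y hy t⟩

/-- **(H3⁻), CRUDE FORM — the contracting side at any rate `κ > 1`**: for `t ≤ 0`, `Σ_{γ} ‖Φ(y γ θ_{e^t})‖ ≤ B · e^{−κ t} = B · e^{κ|t|}`.  In the Tate split this
gives `∫_{t ≤ 0} e^{σt} · B e^{−κt} dt < ∞` iff `σ > κ`, so with `κ ∈ (1, σ)` the abscissa `σ > 1` is reached for every `σ`; the sharp `e^{|t|}` is Poisson (not here).
[cite: WeilBNT1967, Ch. VII §6] [cite: VignerasLNM800, Ch. III §2] -/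
theorem thetaTail_minus_of_lt {K : Set ↥(quatAdelicUnitsOne L Ha)} (hK : IsCompact K)
    {Φ : Matrix (Fin 2) (Fin 2) (AdeleRing (𝓞 L) L) → ℂ}
    (hΦ : Φ ∈ quatSchwartzBruhat L (fun i => ((quatBasis L Ha hHa hdet i : ↥(quatRatSubalgebra L Ha)) : Matrix (Fin 2) (Fin 2) L))) {κ : ℝ} (hκ : 1 < κ) :
    ∃ B : ℝ≥0∞, B ≠ ⊤ ∧ ∀ y ∈ K, ∀ t : ℝ, t ≤ 0 →
      (∑' γ : ↥(quatRatLatticeOne L Ha), ‖Φ (((((y * γ : ↥(quatAdelicUnitsOne L Ha)) : ↥(quatAdelicUnits L Ha)) *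
          quatModuleSection L Ha (Units.mk0 (Real.toNNReal (Real.exp t)) (Real.toNNReal_pos.2 (Real.exp_pos t)).ne') :
            GL (Fin 2) (AdeleRing (𝓞 L) L)) : Matrix (Fin 2) (Fin 2) (AdeleRing (𝓞 L) L)))‖ₑ) ≤ B * ENNReal.ofReal (Real.exp (-κ * t)) := by
  obtain ⟨B, hB, h⟩ := thetaTail_le_exp L hHa hdet hK hΦ hκ
  exact ⟨B, hB, fun y hy t _ => h y hy t⟩

end Heads

end Summit.HodgeConjecture.HodgeConjecture.Cruxes.H413.K2E5QuatThetaBounds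

end
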